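import Literature.AlgebraicGeometry.HodgeTheory.HodgeModelExistence
import Literature.AlgebraicGeometry.Motives.Sweep1
import HarnessLib

/-!
# The Hodge conjecture for Fermat varieties of prime degree or degree `≤ 20` (Ran 1980; Shioda 1979), on real carriers

Family `hodge`, layer `Literature/AlgebraicGeometry/HodgeTheory`. A KNOWN CASE of the Hodge
conjecture stated `B`-free on the real carriers of this layer — those of the summit statement
`Summits/HodgeConjecture` (`HodgeConjectureFor n X`): classes
`c ∈ H²ᵖ(X(ℂ); ℂ) = Literature.AlgebraicTopology.SingularHomology.singularCohomology ℂ ℂ (ComplexPoints X) (2 * p)`,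
rationality `IsRationalClass c`, Hodge type `IsOfHodgeType n X (2p) p p c` (transported through a
Hodge model, file `RationalHodgeClasses`), algebraicity `c ∈ algebraicClasses X p` (`= Nᵖ H²ᵖ`,
the span of the classes of codimension-`p` algebraic cycles, file `AlgebraicClasses`) — exactly as
the sibling file `LefschetzOneOne` does for Lefschetz `(1,1)` and `dim X ≤ 3`.

* `hodgeClasses_algebraic_fermat` — **the Hodge conjecture holds, in every codimension, for the
  Fermat variety `Xⁿₘ : x₀ᵐ + ⋯ + x_{n+1}ᵐ = 0 ⊂ ℙⁿ⁺¹_ℂ` of any dimension `n` whenever the degree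
  `m` is prime or `1 < m ≤ 20`.** Shioda, Proc. Japan Acad. 55A (1979), §2, verbatim: "Given a
  smooth projective variety `X` over the field of complex numbers `ℂ`, the Hodge Conjecture for `X`
  states that the space of rational cohomology classes of type `(d, d)` on `X` is spanned over `ℚ`
  by the classes of algebraic cycles of codimension `d` on `X`. For the Fermat variety
  `X = Xⁿₘ(0)` over `ℂ`, this is non-trivial only in case `n` is even and `d = n/2`. …
  **Theorem 1.** If the condition `(Pⁿₘ)` is satisfied, then the Hodge Conjecture for the Fermat
  variety `Xⁿₘ` is true. The condition `(Pⁿₘ)` has been verified for the following values of `m`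
  and `n` (at least): 1) `m` prime, all `n` (Parry), 2) `m ≤ 20`, all `n` and 3) `m = 21` and
  `n ≤ 10`. Therefore the Hodge Conjecture for `Xⁿₘ` is true for these `m` and `n`." (standing
  assumption `m > 1`, §1; detailed account: Shioda, Math. Ann. 245 (1979) 175–184). The prime case
  is independently Ran, Compositio Math. 42 (1980), Thm. 4.9: "If the Hodge characters for `m` are
  generated by those in dimensions `0` and `2`, e.g., `m` is prime …, then the Hodge conjecture is
  true on `Vⁿₘ` for `n` even. Moreover, if `m` is prime, the Hodge subspace is generated by the
  homology classes of linear spaces" (middle dimension; the other degrees of a smooth hypersurface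
  are Lefschetz's, as Shioda's "non-trivial only in case …" records).

and PROVED consequences in the summit layer's spelling: with the existence of Hodge models
(`nonempty_hodgeModel`, the anti-vacuity conjunct of `HodgeConjectureFor`, a separate named fact)
`hodgeConjectureFor_fermat_of` gives `HodgeConjectureFor n X`, and
`hodgeConjectureFor_fermat_prime_of` is LITERALLY the route decl
`Summit.HodgeConjecture.HodgeConjecture.Theses.KuznetsovCYFactory.FermatPrimeDegreeHC`
(item stmt-HodgeConjecture-1887) from the two facts.

## Rendering and faithfulness

* `X` ranges over `ℂ`-schemes with `Motives.IsFermatVariety n m X` (the reduced closed subscheme of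
  `ℙⁿ⁺¹_ℂ` with underlying set `V₊(x₀ᵐ + ⋯ + x_{n+1}ᵐ)`, file `Motives/Sweep1`) AND
  `Motives.IsSmoothProjective n X` (explicit, because `IsFermatVariety` is set-theoretic; for
  `m ≥ 1`, `n ≥ 1` the Fermat hypersurface is smooth and integral in characteristic `0`, so the pair
  singles out exactly Shioda's `Xⁿₘ` up to `ℂ`-isomorphism; `n = 0` is vacuous for `m ≥ 2`).
* Degree range `m.Prime ∨ (1 < m ∧ m ≤ 20)`: items 1) and 2) of Shioda's list under his standing
  assumption `m > 1`; the extra case `m = 21, n ≤ 10` and the product statements (PJA Thm. 2;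
  Math. Ann. Thm. IV) are NOT stated. (`m = 1`, a hyperplane `≅ ℙⁿ`, is deliberately excluded as
  outside the printed range, although the conjecture is trivial there.)
* "spanned over `ℚ` by the classes of algebraic cycles of codimension `d`" is membership in
  `algebraicClasses X d` for a rational class (module docstring of `LefschetzOneOne`: `ℚ`-span and
  `ℂ`-span membership agree for rational classes); "rational class of type `(d,d)`" is
  `IsRationalClass c ∧ IsOfHodgeType n X (2d) d d c` (`∃` over Hodge models; all models of a smooth
  projective `X` give the same Hodge types, junk analysis in `RationalHodgeClasses`).
* Only the CYCLE PART is the named fact; the conjunct `Nonempty (HodgeModel n X)` of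
  `HodgeConjectureFor` is the separate fact `nonempty_hodgeModel` (GAGA + de Rham + Hodge
  decomposition), combined in the proved corollaries — the pattern of `LefschetzOneOne`.
* The `B`-relative counterpart against an abstract Betti–Hodge datum is
  `Motives.ShiodaFermatStatement B` (`Motives/Sweep1`), a hypothesis schema which is not a
  consequence of `B`'s fields; the present file is the `B`-free form the summit statement uses.
* Upper bound: the fact is an instance family of the summit statement
  (`hodgeClasses_algebraic_fermat_of_hodgeConjectureFor`), so nothing stronger than the Hodge
  conjecture is claimed.

## References

* [Shioda1979PJA] T. Shioda, The Hodge conjecture and the Tate conjecture for Fermat varieties,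
  Proc. Japan Acad. 55A (1979) 111–114, §2, Thm. 1 and the list following it (p. 112) (text read).
* [Shioda1979HodgeFermat] T. Shioda, The Hodge conjecture for Fermat varieties, Math. Ann. 245
  (1979) 175–184 (the detailed account announced in PJA; cite-only, acq-01075).
* [Ran1980] Z. Ran, Cycles on Fermat hypersurfaces, Compositio Math. 42 (1980) 121–142, Thm. 4.9
  (text read, numdam).
* [Deligne2000] P. Deligne, The Hodge conjecture (Clay, 2000), §1.
-/

noncomputable section

namespace Literature.AlgebraicGeometry.HodgeTheory

section HodgeTheory

/-! ### The named fact -/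

/-- **The Hodge conjecture for Fermat varieties of prime degree or degree `≤ 20` (Shioda 1979;
Ran 1980), cycle part on real carriers.** Shioda, Proc. Japan Acad. 55A (1979), §2, Thm. 1 with
the list after it: "If the condition `(Pⁿₘ)` is satisfied, then the Hodge Conjecture for the Fermat
variety `Xⁿₘ` is true. The condition `(Pⁿₘ)` has been verified for … 1) `m` prime, all `n` (Parry),
2) `m ≤ 20`, all `n` … Therefore the Hodge Conjecture for `Xⁿₘ` is true for these `m` and `n`"
(`m > 1` standing, §1; the Hodge conjecture for `X` being "the space of rational cohomology classes
of type `(d, d)` on `X` is spanned over `ℚ` by the classes of algebraic cycles of codimension `d`",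
"non-trivial only in case `n` is even and `d = n/2`"); prime degree independently Ran 1980,
Thm. 4.9 ("if `m` is prime, the Hodge subspace is generated by the homology classes of linear
spaces"). Rendering: for `X` a smooth projective `ℂ`-scheme of dimension `n` which is the Fermat
variety `x₀ᵐ + ⋯ + x_{n+1}ᵐ = 0 ⊂ ℙⁿ⁺¹_ℂ`, with `m` prime or `1 < m ≤ 20`, every rational class of
Hodge type `(p, p)` in `H²ᵖ(X(ℂ); ℂ)` lies in `algebraicClasses X p`.
[cite: Shioda1979PJA, §2 Thm. 1 and the list after it (p. 112)]
[cite: Ran1980, Thm. 4.9] [cite: Shioda1979HodgeFermat, main theorem ((Pⁿₘ) ⇒ HC(Xⁿₘ)), detailed account of the PJA announcement] -/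
def hodgeClasses_algebraic_fermat : Prop :=
  ∀ ⦃n m : ℕ⦄ ⦃X : Motives.SchemeOver ℂ⦄, m.Prime ∨ (1 < m ∧ m ≤ 20) →
    Motives.IsFermatVariety n m X → Motives.IsSmoothProjective n X →
      ∀ (p : ℕ) (c : Literature.AlgebraicTopology.SingularHomology.singularCohomology ℂ ℂ (Motives.ComplexPoints X) (2 * p)),
        IsRationalClass c → IsOfHodgeType n X (2 * p) p p c → c ∈ algebraicClasses X p

variable {n m : ℕ} {X : Motives.SchemeOver ℂ}

/-! ### Upper bound: the fact is an instance family of the Hodge conjecture -/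

/-- The Hodge conjecture for all smooth projective varieties (the summit statement, spelled with
`HodgeConjectureFor`) implies the Fermat statement: it is its instance family over Fermat varieties.
[cite: Deligne2000, §1] -/
theorem hodgeClasses_algebraic_fermat_of_hodgeConjectureFor
    (h : ∀ ⦃n : ℕ⦄ ⦃X : Motives.SchemeOver ℂ⦄, Motives.IsSmoothProjective n X → HodgeConjectureFor n X) :
    hodgeClasses_algebraic_fermat :=
  fun _ _ _ _ _ hX p c hc hpp ↦ (h hX).2 p c hc hpp

/-! ### Consequences in the summit layer's spelling -/

/-- **The Hodge conjecture for the Fermat variety `Xⁿₘ`, `m` prime or `1 < m ≤ 20`**, as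
`HodgeConjectureFor n X`: the fact supplies the cycle part, the existence of Hodge models
(`nonempty_hodgeModel`) the anti-vacuity conjunct. [cite: Shioda1979PJA, §2 Thm. 1 and the list after it (p. 112)]
[cite: Deligne2000, §1] -/
theorem hodgeConjectureFor_fermat_of (h : hodgeClasses_algebraic_fermat) (hA : nonempty_hodgeModel n X)
    (hm : m.Prime ∨ (1 < m ∧ m ≤ 20)) (hF : Motives.IsFermatVariety n m X)
    (hX : Motives.IsSmoothProjective n X) : HodgeConjectureFor n X :=
  ⟨hA hX, fun p c hc hpp ↦ h hm hF hX p c hc hpp⟩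

/-- **Prime degree (Ran 1980, Thm. 4.9; Shioda 1979, list item 1)**, literally the route statement
`FermatPrimeDegreeHC` of `Summits/HodgeConjecture/…/Theses/KuznetsovCYFactory`: from the fact and the
existence of Hodge models for all smooth projective varieties, the Hodge conjecture holds for every
smooth projective Fermat variety of prime degree `ℓ` and any dimension `n`.
[cite: Ran1980, Thm. 4.9] [cite: Shioda1979PJA, §2 Thm. 1 and the list after it (p. 112)] -/
theorem hodgeConjectureFor_fermat_prime_of (h : hodgeClasses_algebraic_fermat)
    (hA : ∀ (n : ℕ) (X : Motives.SchemeOver ℂ), nonempty_hodgeModel n X) :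
    ∀ (n ℓ : ℕ) (X : Motives.SchemeOver ℂ), ℓ.Prime → Motives.IsFermatVariety n ℓ X →
      Motives.IsSmoothProjective n X → HodgeConjectureFor n X :=
  fun n _ X hℓ hF hX ↦ hodgeConjectureFor_fermat_of h (hA n X) (Or.inl hℓ) hF hX

/-- **Degree `≤ 20` (Shioda 1979, list item 2)**, e.g. the quartic (`m = 4`) and sextic (`m = 6`)
Fermat varieties: from the fact and the existence of Hodge models, the Hodge conjecture holds for
every smooth projective Fermat variety of degree `1 < m ≤ 20`.
[cite: Shioda1979PJA, §2 Thm. 1 and the list after it (p. 112)] -/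
theorem hodgeConjectureFor_fermat_le_twenty_of (h : hodgeClasses_algebraic_fermat)
    (hA : ∀ (n : ℕ) (X : Motives.SchemeOver ℂ), nonempty_hodgeModel n X) :
    ∀ (n m : ℕ) (X : Motives.SchemeOver ℂ), 1 < m → m ≤ 20 → Motives.IsFermatVariety n m X →
      Motives.IsSmoothProjective n X → HodgeConjectureFor n X :=
  fun n _ X h1 h20 hF hX ↦ hodgeConjectureFor_fermat_of h (hA n X) (Or.inr ⟨h1, h20⟩) hF hX

end HodgeTheory

end Literature.AlgebraicGeometry.HodgeTheory

end
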